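import Literature.IUT.HodgeArakelov.ThetaEvaluationModelEvDiagram
import Literature.IUT.HodgeArakelov.ThetaEvaluationModelEvRetractionTop
import Literature.IUT.HodgeArakelov.EtaleThetaDataOfSettingKummerTower
import Literature.IUT.HodgeArakelov.MonoThetaProjectiveBridgeEtTh

/-!
# [IUTchII] Cor. 1.12 (iii) at the model `Π = Π^tp_X̲̲`: the residual input `hcU` (with the datum `cU`) and the
# retraction side conditions `hlift`/`hemb` DISCHARGED from the cyclotome tower — proof companion

Proof-only companion (abc-iut cell, D-0067 wave 4, seat abc-iut-w4-d007 gen 4; layer L6; node **IUTchII:Cor1.12(iii)**) to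
abc-iut-w4-d043's `ThetaEvaluationModelEvDiagram.lean` (p425654: `EtaleLevels.cor112_iii_model` — [IUTchII] Cor. 1.12 (iii),
the diagram `(†μ,×μ)`, for the MODEL theta-evaluation datum with constants `ℚ̄_pˣ` through `ε`, `U := 𝒪^×_{ℚ̄_p}`, the
canonical retractions of `ε`; residual named inputs there: `hcU`, `[G_{ℚ_p} : ε(D_{μ_-})] < ∞`, `hDq`/`hlift`/`hemb`, `P₀`),
to abc-iut-w4-d043's `ThetaEvaluationModelEvRetractionTop.lean` (`hlift_of_isCompact`/`hemb_of_isCompact`, p421351) and to this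
seat's `EtaleThetaDataOfSettingKummerTower.lean` (p422741: `exists_cyclotomeCoefficients_of_cyclotomeTower`); the Cor. 1.12 (ii)
twin of the present file is this seat's `ThetaEvaluationModelEvOfTower.lean` (p425297).  No definitions; nothing of those files is
restated.

S. Mochizuki, *Inter-universal Teichmüller theory II*, kurims manuscript (Dec. 2020), Cor. 1.12 (iii) p. 58
[cite: Mochizuki2012, Cor 1.12 (iii) p.58]; *The étale theta function …*, Publ. RIMS **45** (2009), §1 p. 238 "`(Ẑ(1) ≅) Δ_Θ`",
Cor. 2.19 (ii) p. 290 [cite: MochizukiEtTh2009, Cor 2.19 (ii) p.64].  Claim key `Mochizuki2012` (D-0012, DISPUTED); nothing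
here takes a side on [IUTchIII] Cor. 3.12.

WHAT IS DISCHARGED.  In `cor112_iii_model` the residual NON-PRINT inputs were
* `hcU : Function.Bijective cU.hom` — the change of coefficient cyclotome `cU : Λ(ℚ̄_pˣ) = Ẑ(1) → l·Δ_Θ` (Cor. 1.11 (a) at the
  model) is an isomorphism — with `cU` itself a free datum, and
* `hlift`/`hemb` — the topological side conditions of the canonical retractions `LevelRetraction.ofAugmentation ε D_{μ_-}`.
Both follow from data the model ALREADY carries: the all-level cyclotome identifications `mods M : D.CyclotomeMod l M` with
their compatibility `hmods` (abc-iut-L2-t8's `CyclotomeTower`, here abc-iut-w4-d043's chain `EtaleLevels.cyclotomeTower mods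
hmods`), the origin guard `IsEtThOrigin` (F-2498), compactness of `Δ_Θ` (GAP-LEDGER G-w5d187-1) and of `D_{μ_-}`:
`cU` with `hcU` is this seat's `exists_cyclotomeCoefficients_of_cyclotomeTower`, pinned down by `(mods M).red (cU ζ) = ζ_M`;
`hlift`/`hemb` are abc-iut-w4-d043's `hlift_of_isCompact`/`hemb_of_isCompact`.

PROVED: **`EtaleLevels.cor112_iii_model_of_cyclotomeTower`** — for ANY pointed inversion `I` with `D_{μ_-}` compact, meeting `Δ`
trivially and with `ε(D_{μ_-})` of finite index, every [AbsTopIII]-output interface `A`, `G ≅ G_k` and non-empty `P₀`: THERE IS a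
bijective change of coefficient cyclotome `cU` with `(mods M).red (cU ζ) = ζ_M` for all `M` such that the diagram `(†μ,×μ)` of
Cor. 1.12 (iii) EXISTS for the model theta-evaluation datum built with it (canonical retractions from compactness), with last
arrow `{π ∘ (Kummer identification)⁻¹ | π ∈ P₀}`.  Residual NAMED inputs: `hDq : D_{μ_-} ∩ Ker ε = 1`, `hDc : IsCompact D_{μ_-}`,
`[(D_{μ_-}.map ε).FiniteIndex]`, `[T2Space G_{ℚ_p}]`, `P₀` ≠ ∅ (the `α_×`-induced identifications; abc-iut-w4-d043's announced
sequel), `hO : IsEtThOrigin` (F-2498), `hΔ : IsCompact Δ_Θ` (G-w5d187-1) — and the model data `mods`/`hmods`/`h15`/`L`/`hZ`/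
`hcharY`/`hlim` of abc-iut-w4-d030's natural projective system (`hlim` itself a theorem, `bijective_rigidLimHom`: see the
`_rigid` form).  GONE: `hcU` (and the datum `cU`), `hlift`, `hemb` (besides `hκ`, `hμ`, the Kummer identification, `hψA`, `hU`
already discharged by abc-iut-w4-d043).  Typed ≠ proved for the residual inputs; instantiated ≠ endorsed.
-/

noncomputable section

namespace Literature.IUT.HodgeArakelov

open Literature.AnabelianGeometry.EtaleTheta Literature.AnabelianGeometry.SemiGraphs CohomologySystemOfContH1
open Literature.AnabelianGeometry.AbsoluteAnabelian
open scoped Literature.AnabelianGeometry.EtaleTheta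

namespace EtaleLevels

variable {p : ℕ} [Fact p.Prime] {D : Literature.AnabelianGeometry.EtaleTheta.ThetaSetting p}
  {E : D.EtaleThetaData} {l : ℕ} (C : E.DoubleUnderline l) (hC : D.Compat) (hS : D.Sec2Hyps)
  (hl : l.Prime) (hp2 : p ≠ 2) (hpl : p ≠ l) (hζ : ∃ ζ : D.K, IsPrimitiveRoot ζ (4 * l))
  (mods : ∀ M : ℕ+, D.CyclotomeMod l M)
  (f : contCocycles D.toTheta D.DeltaTheta C.GtpYdduu) (hf : f ∈ C.rootCocycles hC)
  (hmods : ∀ (M M' : ℕ+) (h : (M : ℕ) ∣ (M' : ℕ)) (x : D.lDeltaTheta l),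
    MuN.red p M M' h ((mods M').red x) = (mods M).red x)
  (h15 : Literature.AnabelianGeometry.EtaleTheta.ThetaSetting.Prop15iii E hC) (L : C.CuspLabels)
  (hZ : ∀ M : ℕ+, Nonempty (ModelCyclotomes.lDeltaQuot (C.rigidData (mods M) hC hS h15 L) ≃*
    Literature.IUT.HodgeTheaters.ZHat))
  (hcharY : EtaleThetaDataOfSetting.PiYddCharacteristic C)
  (hlim : Function.Bijective (rigidLimHom C hC hS hl hp2 hpl hζ mods f hf hmods h15 L hZ))
  (Env : EnvOfGroup (setting C hC hS hl hp2 hpl hζ mods f hf)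
    (modelSystem C hC hS hl hp2 hpl hζ mods f hf hmods h15 L hZ).PiX)
  (I : PointedInversion Env (thetaEnvData C hC hS hl hp2 hpl hζ mods f hf hmods h15 L hZ hcharY hlim).D)
  (hDq : ∀ d ∈ I.Dmu, EtaleThetaDataOfSetting.aug C d = 1 → d = 1)
  (hDc : IsCompact (I.Dmu : Set (modelSystem C hC hS hl hp2 hpl hζ mods f hf hmods h15 L hZ).PiX))
  (ρlim : (EtaleThetaDataOfSetting.coh C).lim ≃+ (EtaleThetaDataOfSetting.coh C).lim)

/-! ### Cor. 1.12 (iii) at the model, `hcU`/`cU`/`hlift`/`hemb` discharged -/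

/-- **[IUTchII] Cor. 1.12 (iii) at the model `Π := Π^tp_X̲̲`, with `hcU` (and the coefficient datum `cU` itself), `hlift` and
`hemb` DISCHARGED.**  For abc-iut-w4-d043's model theta-evaluation datum over ANY pointed inversion `I` whose decomposition
group `D_{μ_-}` is compact, the canonical retractions of `ε` (`LevelRetraction.ofAugmentation` with `hlift`/`hemb` from
"`D_{μ_-}` compact", `hlift_of_isCompact`/`hemb_of_isCompact`) and print's constants `𝒪^×_{ℚ̄_p} ⊆ ℚ̄_pˣ` acted on through `ε`:
THERE IS a bijective change of coefficient cyclotome `cU : Λ(ℚ̄_pˣ) = Ẑ(1) ⥲ l·Δ_Θ` — the one inverse to the model's own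
identifications, `(mods M).red (cU ζ) = ζ_M` for every `M` (this seat's `exists_cyclotomeCoefficients_of_cyclotomeTower` on
abc-iut-w4-d043's chain tower `cyclotomeTower mods hmods`) — such that, for every [AbsTopIII]-output interface `A`, `G ≅ G_k`
and non-empty collection `P₀` of identifications `𝒪^×_{ℚ̄_p}/μ ≅ O^{×μ}(G)`, THE DIAGRAM `(†μ,×μ)` of Cor. 1.12 (iii) EXISTS
for the datum built with `cU` — `MuXmuDiagram Ev A G Q κ`, `Q :=` the torsion of `lim_J H¹(Π_Ÿ|_J, Π_μ)`, `κ :=` its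
inclusion — with last arrow `{π ∘ (Kummer identification)⁻¹ | π ∈ P₀}`: abc-iut-w4-d043's `cor112_iii_model` with `hcU` the
bijectivity just constructed.  Residual named inputs: `hDq`, `hDc`, `[(D_{μ_-}.map ε).FiniteIndex]`, `[T2Space G_{ℚ_p}]`,
`P₀`, `hO : IsEtThOrigin` (F-2498), `hΔ : IsCompact Δ_Θ` (GAP-LEDGER G-w5d187-1).
[claim: Mochizuki2012, status: disputed] (IUTchII §1 Cor 1.12 (iii), kurims p.58) -/
theorem cor112_iii_model_of_cyclotomeTower [T2Space (GQp p)]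
    [(Subgroup.map (EtaleThetaDataOfSetting.aug C) I.Dmu).FiniteIndex]
    (hO : D.IsEtThOrigin) (hΔ : IsCompact (D.DeltaTheta : Set D.GtpTheta))
    (A : AbsTopMonoids (setting C hC hS hl hp2 hpl hζ mods f hf)) (G : IsoClass (setting C hC hS hl hp2 hpl hζ mods f hf).Gk)
    (P₀ : Set ((↥(unitGroup ℚ_[p] (PadicAlgCl p)) ⧸ CommGroup.torsion ↥(unitGroup ℚ_[p] (PadicAlgCl p))) ≃* A.Oxmu G))
    (hP₀ : P₀.Nonempty) :
    ∃ cU : CyclotomeCoefficients (EtaleThetaDataOfSetting.phi C) (D.lDeltaTheta l) (PadicAlgCl p)ˣ,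
      Function.Bijective cU.hom ∧
      (∀ (ζ : Literature.AnabelianGeometry.EtaleTheta.cyclotome (PadicAlgCl p)ˣ) (M : ℕ+),
        (((mods M).red (cU.hom ζ) : MuN p M) : (PadicAlgCl p)ˣ) = (ζ : ℕ+ → (PadicAlgCl p)ˣ) M) ∧
      ∃ Δ : MuXmuDiagram
          (thetaEvaluation C hC hS hl hp2 hpl hζ mods f hf hmods h15 L hZ hcharY hlim Env I
            (LevelRetraction.ofAugmentation (EtaleThetaDataOfSetting.phi C) (D.lDeltaTheta l)
              (EtaleThetaDataOfSetting.aug C) I.Dmu hDq (EtaleThetaDataOfSetting.PiYdd C)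
              (EtaleThetaDataOfSetting.continuous_aug C) (aug_ker_acts_trivially C)
              (hlift_of_isCompact (EtaleThetaDataOfSetting.aug C) I.Dmu (EtaleThetaDataOfSetting.continuous_aug C) hDc)
              (hemb_of_isCompact (EtaleThetaDataOfSetting.aug C) I.Dmu (EtaleThetaDataOfSetting.continuous_aug C) hDc hDq))
            cU (EtaleThetaDataOfSetting.isOpen_stabilizer_units C) (EtaleThetaDataOfSetting.finiteIndex_stabilizer_units C)
            (unitGroup ℚ_[p] (PadicAlgCl p)) ρlim) A G
          ↥(AddCommGroup.torsion (thetaEnvData C hC hS hl hp2 hpl hζ mods f hf hmods h15 L hZ hcharY hlim).cohEnv.lim)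
          (AddCommGroup.torsion (thetaEnvData C hC hS hl hp2 hpl hζ mods f hf hmods h15 L hZ hcharY hlim).cohEnv.lim).subtype,
        Δ.poly₄₅ = {e | ∃ π ∈ P₀,
          ∀ (u : ↥(unitGroup ℚ_[p] (PadicAlgCl p)))
            (m : ↥(thetaEvaluation C hC hS hl hp2 hpl hζ mods f hf hmods h15 L hZ hcharY hlim Env I
              (LevelRetraction.ofAugmentation (EtaleThetaDataOfSetting.phi C) (D.lDeltaTheta l)
                (EtaleThetaDataOfSetting.aug C) I.Dmu hDq (EtaleThetaDataOfSetting.PiYdd C)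
                (EtaleThetaDataOfSetting.continuous_aug C) (aug_ker_acts_trivially C)
                (hlift_of_isCompact (EtaleThetaDataOfSetting.aug C) I.Dmu (EtaleThetaDataOfSetting.continuous_aug C) hDc)
                (hemb_of_isCompact (EtaleThetaDataOfSetting.aug C) I.Dmu (EtaleThetaDataOfSetting.continuous_aug C) hDc hDq))
              cU (EtaleThetaDataOfSetting.isOpen_stabilizer_units C) (EtaleThetaDataOfSetting.finiteIndex_stabilizer_units C)
              (unitGroup ℚ_[p] (PadicAlgCl p)) ρlim).MxTM),
            (m : (thetaEvaluation C hC hS hl hp2 hpl hζ mods f hf hmods h15 L hZ hcharY hlim Env I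
              (LevelRetraction.ofAugmentation (EtaleThetaDataOfSetting.phi C) (D.lDeltaTheta l)
                (EtaleThetaDataOfSetting.aug C) I.Dmu hDq (EtaleThetaDataOfSetting.PiYdd C)
                (EtaleThetaDataOfSetting.continuous_aug C) (aug_ker_acts_trivially C)
                (hlift_of_isCompact (EtaleThetaDataOfSetting.aug C) I.Dmu (EtaleThetaDataOfSetting.continuous_aug C) hDc)
                (hemb_of_isCompact (EtaleThetaDataOfSetting.aug C) I.Dmu (EtaleThetaDataOfSetting.continuous_aug C) hDc hDq))
              cU (EtaleThetaDataOfSetting.isOpen_stabilizer_units C) (EtaleThetaDataOfSetting.finiteIndex_stabilizer_units C)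
              (unitGroup ℚ_[p] (PadicAlgCl p)) ρlim).Hd) =
                Multiplicative.toAdd (h1LimKummer (EtaleThetaDataOfSetting.phi C) (D.lDeltaTheta l) I.Dmu cU
                  (EtaleThetaDataOfSetting.isOpen_stabilizer_units C) (EtaleThetaDataOfSetting.finiteIndex_stabilizer_units C)
                  u) →
              e (Multiplicative.ofAdd (QuotientAddGroup.mk m)) = π (QuotientGroup.mk u)} := by
  -- the chain tower carrying the model's identifications, and the coefficient iso built from it
  obtain ⟨cU, hcU, hlev⟩ := EtaleThetaDataOfSetting.exists_cyclotomeCoefficients_of_cyclotomeTower C hO hΔ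
    (cyclotomeTower mods hmods (dvd_refl ((1 : ℕ+) : ℕ)))
  refine ⟨cU, hcU, fun ζ M => ?_, ?_⟩
  · -- the chain tower's all-level identification at `M` is `mods M` (compatibility `hmods`)
    have hmod : ((cyclotomeTower mods hmods (dvd_refl ((1 : ℕ+) : ℕ))).modAll M).red (cU.hom ζ) =
        (mods M).red (cU.hom ζ) := by
      rw [ThetaSetting.CyclotomeTower.modAll_red, ThetaSetting.CyclotomeTower.redVia_apply]
      exact hmods M _ _ (cU.hom ζ)
    rw [← hmod]
    exact hlev ζ M
  · exact cor112_iii_model C hC hS hl hp2 hpl hζ mods f hf hmods h15 L hZ hcharY hlim Env I hDq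
      (hlift_of_isCompact (EtaleThetaDataOfSetting.aug C) I.Dmu (EtaleThetaDataOfSetting.continuous_aug C) hDc)
      (hemb_of_isCompact (EtaleThetaDataOfSetting.aug C) I.Dmu (EtaleThetaDataOfSetting.continuous_aug C) hDc hDq)
      cU ρlim hcU A G P₀ hP₀

end EtaleLevels

end Literature.IUT.HodgeArakelov

end
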